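import Mathlib
import HarnessLib.Audit
import Summits.PneNP.PneNP.Theorems.PstarCrossCasePEmptyW2

/-!
# The blind free CROSS gate, node N1, step 2: CONTROLLED private edges — single-variable flips, toggles, and the constants `c_j` (O2 / E1; prover-1 g22)

FRONTIER range-avoidance ladder, rung F-N3 (`stmt-PneNP-19007`), cell `pnp-ideate`; restricted-model proof complexity — nothing here bears on `P` versus `NP`.

Cross data `B`, `q = q_{(1,0)}` with polar form `β = polarDir I B (1,0)`.  A private tree edge `j` (AND pair `(a_j, b_j)`) is CONTROLLED when `q` has
no linear term in `a_j, b_j` and `β(e_w, e_{a_j}) = β(e_w, e_{b_j}) = 0` for every variable `w` off the pair — which step 1 (`PstarCrossCasePEmptyW2`,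
`PstarCrossCornerReads`) proves for GOOD private edges in regime P (`controlled_of_good`).  For a controlled edge:

* `qDir_add_single` — flipping `a_j` changes `q` by `x_{b_j} · c_j`, `c_j := β(e_{b_j}, e_{a_j})` (`cval`); `u_add_single` — and changes `u_e` by
  `x_{b_j} · [j ∈ D e]` (privacy: no other tree monomial reads `a_j`);
* **`toggle`** — at every point there is a point differing only on `{a_j, b_j}` where the monomial of `j` is flipped: `q` moves by `c_j` and every
  `u_e` by `[j ∈ D e]`;
* **`cval_eq_one_of_A` / `cval_eq_one_of_B`** — a controlled private edge of `D_p ∖ D_q` (resp. `D_q ∖ D_p`) has `c_j = 1`: toggle it at the (M0)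
  witness of `e_p` (resp. `e_q`) in `Z(q)` (`PstarCrossCaseP.exists_q_p/q`) to land in the corner, where `q = 1` (`corner_const`);
  `cval_C_add` — a controlled edge of `D_p ∩ D_q` toggled together with one of `D_q ∖ D_p` gives `c_c + c_b = 1`.
So in node N1 every good private edge of `D_p Δ D_q` is XOR-read by `w₂` across its monomial (`c_j = 1`); three of them make `q` of rank `≥ 6`
(step 3), whence `q_{(0,1)} ∈ {0, q}` by rank rigidity and the first constraint touches no good private edge either.
-/

set_option linter.dupNamespace false -- `Summit.PneNP.PneNP.…`: summit = sub-problem name (D-0017 single-conjunct layout)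

open Finset Literature.Computability.Complexity
open Summit.PneNP.PneNP.Theorems.PstarFibrePolys (bit)
open Summit.PneNP.PneNP.Theorems.PstarTyped (Typed)
open Summit.PneNP.PneNP.Theorems.PstarSALevel (varSet BoundaryExpanding SimpleOverlap)
open Summit.PneNP.PneNP.Theorems.PstarCentreFree (vars_mem_varSet)
open Summit.PneNP.PneNP.Theorems.PstarProductRank (qform polar)
open Summit.PneNP.PneNP.Theorems.PstarPathRank (AndAdj polar_basis polar_self_and)
open Summit.PneNP.PneNP.Theorems.PstarReadSumset (V2)
open Summit.PneNP.PneNP.Theorems.PstarChordSystem (ChordSystem)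
open Summit.PneNP.PneNP.Theorems.PstarChordBridgeTools
open Summit.PneNP.PneNP.Theorems.PstarChordBridge
open Summit.PneNP.PneNP.Theorems.PstarChordBridgeForcing (freeMon freePolar gam sys_u_eq qform_add')
open Summit.PneNP.PneNP.Theorems.PstarChordBridgeBasis (qDir polarDir)
open Summit.PneNP.PneNP.Theorems.PstarChordBridgeCorner (qDir_add)
open Summit.PneNP.PneNP.Theorems.PstarCrossData (CrossData)
open Summit.PneNP.PneNP.Theorems.PstarCrossSystem
open Summit.PneNP.PneNP.Theorems.PstarCrossCorner (PrivEdge)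
open Summit.PneNP.PneNP.Theorems.PstarCrossCornerReads (Switch polarDir10_zero qDir10_single)
open Summit.PneNP.PneNP.Theorems.PstarCrossCaseP (exists_q_p exists_q_q)
open Summit.PneNP.PneNP.Theorems.PstarCrossCasePEmptyW2 (corner_const Avail not_mem_privs_of_disjoint)

namespace Summit.PneNP.PneNP.Theorems.PstarCrossCasePEmptyToggle

variable {n m : ℕ}

section

variable (I : LocalMap 4 n m) {r : ℕ} {B : BridgeData n m} {e_p e_q g₀ : Fin m}

/-- A private tree edge is CONTROLLED (by `q_{(1,0)}`): no linear term in its AND variables, no polar with variables off its pair. -/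
def Controlled (I : LocalMap 4 n m) (B : BridgeData n m) (j : Fin m) : Prop :=
  PrivEdge I B j ∧ ∀ s : Fin 4, (s = 2 ∨ s = 3) →
    qDir I B (1, 0) (Pi.single (I.vars j s) 1) = qDir I B (1, 0) 0 ∧
    ∀ w, w ≠ I.vars j 2 → w ≠ I.vars j 3 → polarDir I B (1, 0) (Pi.single w 1) (Pi.single (I.vars j s) 1) = 0

/-- The constant of a private edge: `c_j = β(e_{b_j}, e_{a_j})` (`= [j ∈ T₂]`). -/
def cval (I : LocalMap 4 n m) (B : BridgeData n m) (j : Fin m) : ZMod 2 :=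
  polarDir I B (1, 0) (Pi.single (I.vars j 3) 1) (Pi.single (I.vars j 2) 1)

/-- **Good private edges are controlled** (regime P; step 1). -/
theorem controlled_of_good (hI : I.IsPure xorAndPred) (hT : Typed I) (hD : CrossData I r B e_p e_q g₀) (hSR : ((sys I B).vsys e_p e_q).SingleRead)
    {π : Fin m} (hπ : PrivEdge I B π) (havail : ∀ k, PrivEdge I B k → Avail I B e_p e_q {π, k}) : Controlled I B π := by
  classical
  have hK := corner_const I hI hT hD hSR
  obtain ⟨S₀, hS₀, hd₀⟩ := havail π hπ
  have hπS₀ : π ∉ S₀ := fun h => disjoint_left.1 hd₀ h (mem_insert_self π _)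
  have hone : ∀ k, PrivEdge I B k → ∀ {u : Fin n}, (I.vars k 2 = u ∨ I.vars k 3 = u) →
      ∃ S, Switch I B e_p e_q S ∧ π ∉ S ∧ u ∉ privs I S := by
    intro k hk u hku
    obtain ⟨S, hSw, hd⟩ := havail k hk
    refine ⟨S, hSw, fun h => disjoint_left.1 hd h (mem_insert_self π _), ?_⟩
    have hkS : k ∉ S := fun h => disjoint_left.1 hd h (mem_insert_of_mem (mem_singleton_self k))
    rcases hku with h | h
    · exact not_mem_privs_of_disjoint I hSw.1 hk hkS (Or.inl rfl) h
    · exact not_mem_privs_of_disjoint I hSw.1 hk hkS (Or.inr rfl) h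
  have hlin : ∀ u ∈ privs I S₀, ∃ S, Switch I B e_p e_q S ∧ π ∉ S ∧ u ∉ privs I S := by
    intro u hu
    obtain ⟨j, hj, hju⟩ := (mem_privs I).1 hu
    exact hone j (hS₀.1 j hj) hju
  have hmon : ∀ w, w ≠ I.vars π 2 → w ≠ I.vars π 3 → ∃ S, Switch I B e_p e_q S ∧ π ∉ S ∧ w ∉ privs I S := by
    intro w _ _
    by_cases hw : ∃ k, PrivEdge I B k ∧ (I.vars k 2 = w ∨ I.vars k 3 = w)
    · obtain ⟨k, hk, hkw⟩ := hw
      exact hone k hk hkw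
    · refine ⟨S₀, hS₀, hπS₀, fun hwS => hw ?_⟩
      obtain ⟨j, hj, hjw⟩ := (mem_privs I).1 hwS
      exact ⟨j, hS₀.1 j hj, hjw⟩
  refine ⟨hπ, fun s hs => ⟨qDir10_single I hI hD hK hπ hs hS₀ hπS₀ hlin, fun w hw2 hw3 => ?_⟩⟩
  obtain ⟨S, hSw, hπS, hwS⟩ := hmon w hw2 hw3
  exact polarDir10_zero I hI hD hK hπ hs hw2 hw3 hSw hπS hwS

/-! ## Single-variable flips -/

/-- Expansion of a vector in the standard basis. -/
private theorem eq_sum_single (x : Fin n → ZMod 2) : x = ∑ w, x w • (Pi.single w (1 : ZMod 2) : Fin n → ZMod 2) := by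
  funext v
  rw [Finset.sum_apply]
  simp only [Pi.smul_apply, Pi.single_apply, smul_eq_mul, mul_ite, mul_one, mul_zero]
  rw [Finset.sum_ite_eq]
  simp

/-- A bilinear form against a basis vector, expanded over the coordinates of the first argument. -/
theorem bilin_apply_single (Bf : LinearMap.BilinForm (ZMod 2) (Fin n → ZMod 2)) (x : Fin n → ZMod 2) (u : Fin n) :
    Bf x (Pi.single u 1) = ∑ w, x w * Bf (Pi.single w 1) (Pi.single u 1) := by
  conv_lhs => rw [eq_sum_single x]
  rw [map_sum, LinearMap.sum_apply]
  refine sum_congr rfl fun w _ => ?_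
  rw [LinearMap.map_smul, LinearMap.smul_apply, smul_eq_mul]

/-- The polar form `polarDir` is alternating. -/
theorem polarDir_self (mv : V2) (x : Fin n → ZMod 2) : polarDir I B mv x x = 0 := by
  unfold PstarChordBridgeBasis.polarDir PstarChordBridgeForcing.freePolar
  simp only [LinearMap.add_apply, LinearMap.smul_apply, polar_self_and, smul_zero, add_zero]

/-- The polar form `polarDir` is symmetric. -/
theorem polarDir_symm (mv : V2) (x y : Fin n → ZMod 2) : polarDir I B mv x y = polarDir I B mv y x := by
  unfold PstarChordBridgeBasis.polarDir PstarChordBridgeForcing.freePolar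
  simp only [LinearMap.add_apply, LinearMap.smul_apply]
  rw [PstarPathRank.polar_symm_and I B.T₁ x y, PstarPathRank.polar_symm_and I (freeMon I B.N B.G₁) x y,
    PstarPathRank.polar_symm_and I B.T₂ x y, PstarPathRank.polar_symm_and I (freeMon I B.N B.G₂) x y]

/-- The two AND slots. -/
private theorem slots {s s' : Fin 4} (hs : s = 2 ∨ s = 3) (hs' : s' = 2 ∨ s' = 3) (hss' : s ≠ s') :
    (s = 2 ∧ s' = 3) ∨ (s = 3 ∧ s' = 2) := by
  rcases hs with rfl | rfl <;> rcases hs' with rfl | rfl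
  · exact absurd rfl hss'
  · exact Or.inl ⟨rfl, rfl⟩
  · exact Or.inr ⟨rfl, rfl⟩
  · exact absurd rfl hss'

/-- **Flipping one AND variable of a controlled edge**: `q(x + e_u) = q(x) + x_{u'} · β(e_{u'}, e_u)`. -/
theorem qDir_add_single {j : Fin m} (hj : Controlled I B j) {s s' : Fin 4} (hs : s = 2 ∨ s = 3) (hs' : s' = 2 ∨ s' = 3) (hss' : s ≠ s')
    (x : Fin n → ZMod 2) :
    qDir I B (1, 0) (x + Pi.single (I.vars j s) 1) =
      qDir I B (1, 0) x + x (I.vars j s') * polarDir I B (1, 0) (Pi.single (I.vars j s') 1) (Pi.single (I.vars j s) 1) := by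
  classical
  obtain ⟨hlin, hpol⟩ := hj.2 s hs
  rw [qDir_add, bilin_apply_single, ← Finset.sum_erase_add _ _ (mem_univ (I.vars j s')), Finset.sum_eq_zero]
  · have e0 : ∀ a b : ZMod 2, a = b → ∀ q t : ZMod 2, q + a + b + (0 + t) = q + t := by decide
    exact e0 _ _ hlin _ _
  · intro w hw
    have hws' : w ≠ I.vars j s' := ne_of_mem_erase hw
    by_cases hws : w = I.vars j s
    · rw [hws, polarDir_self, mul_zero]
    · have h23 : w ≠ I.vars j 2 ∧ w ≠ I.vars j 3 := by
        rcases slots hs hs' hss' with ⟨rfl, rfl⟩ | ⟨rfl, rfl⟩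
        · exact ⟨hws, hws'⟩
        · exact ⟨hws', hws⟩
      rw [hpol w h23.1 h23.2, mul_zero]

/-- AND-adjacency inside the core at an AND variable of a private edge means the edge itself, through the mate. -/
theorem andAdj_priv_iff (hI : I.IsPure xorAndPred) {P : Finset (Fin m)} (hP : P ⊆ B.J₀) {j : Fin m} (hj : PrivEdge I B j) {s s' : Fin 4}
    (hs : s = 2 ∨ s = 3) (hs' : s' = 2 ∨ s' = 3) (hss' : s ≠ s') (w : Fin n) :
    AndAdj I P w (I.vars j s) ↔ j ∈ P ∧ w = I.vars j s' := by
  have h23 : I.vars j 2 ≠ I.vars j 3 := fun h => absurd (hI.2 j h) (by decide)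
  constructor
  · rintro ⟨k, hk, hkw⟩
    have hkj : k = j := by
      by_contra hne
      have h := hj.2 k (hP hk) hne
      have : I.vars j s ∉ varSet I k := by rcases hs with rfl | rfl; exacts [h.1, h.2]
      rcases hkw with ⟨-, h3⟩ | ⟨h2, -⟩
      · exact this (h3 ▸ vars_mem_varSet I k 3)
      · exact this (h2 ▸ vars_mem_varSet I k 2)
    subst hkj
    refine ⟨hk, ?_⟩
    rcases slots hs hs' hss' with ⟨rfl, rfl⟩ | ⟨rfl, rfl⟩
    · rcases hkw with ⟨-, h3⟩ | ⟨-, h3⟩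
      · exact absurd h3.symm h23
      · exact h3.symm
    · rcases hkw with ⟨h2, -⟩ | ⟨h2, -⟩
      · exact h2.symm
      · exact absurd h2 h23
  · rintro ⟨hjP, rfl⟩
    rcases slots hs hs' hss' with ⟨rfl, rfl⟩ | ⟨rfl, rfl⟩
    · exact ⟨j, hjP, Or.inr ⟨rfl, rfl⟩⟩
    · exact ⟨j, hjP, Or.inl ⟨rfl, rfl⟩⟩

/-- **Flipping one AND variable of a private edge changes `u_e` by `x_{u'} · [j ∈ D e]`** (no other tree monomial reads the variable). -/
theorem u_add_single (hI : I.IsPure xorAndPred) (hS : SimpleOverlap I) (hW : B.WF I) {e : Fin m} (he : e ∈ B.N) {j : Fin m} (hj : PrivEdge I B j)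
    {s s' : Fin 4} (hs : s = 2 ∨ s = 3) (hs' : s' = 2 ∨ s' = 3) (hss' : s ≠ s') (x : Fin n → ZMod 2) :
    (sys I B).u e (x + Pi.single (I.vars j s) 1) = (sys I B).u e x + x (I.vars j s') * (if j ∈ B.D e then 1 else 0) := by
  classical
  have hDJ : B.D e ⊆ B.J₀ := (hW.hD e he).trans sdiff_subset
  rw [sys_u_eq, sys_u_eq, qform_add', PstarChordBridgeFlat.qform_single I hI, PstarChordBridgeFlat.qform_zero, add_zero, add_zero, add_assoc]
  congr 1
  rw [bilin_apply_single, ← Finset.sum_erase_add _ _ (mem_univ (I.vars j s')), Finset.sum_eq_zero, zero_add]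
  · rw [polar_basis I hI hS]
    by_cases hjD : j ∈ B.D e
    · rw [if_pos ((andAdj_priv_iff I hI hDJ hj hs hs' hss' _).2 ⟨hjD, rfl⟩), if_pos hjD]
    · rw [if_neg hjD, if_neg (fun h => hjD ((andAdj_priv_iff I hI hDJ hj hs hs' hss' _).1 h).1)]
  · intro w hw
    rw [polar_basis I hI hS, if_neg (fun h => ne_of_mem_erase hw ((andAdj_priv_iff I hI hDJ hj hs hs' hss' _).1 h).2), mul_zero]

/-! ## Toggling the monomial of a controlled edge -/

/-- **TOGGLE.**  At every point there is a point differing only on the AND pair of the controlled edge `j` at which `q` has moved by `c_j` and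
every prescribed product `u_e` by `[j ∈ D e]`. -/
theorem toggle (hI : I.IsPure xorAndPred) (hS : SimpleOverlap I) (hW : B.WF I) {j : Fin m} (hj : Controlled I B j) (x : Fin n → ZMod 2) :
    ∃ x' : Fin n → ZMod 2, (∀ v, v ≠ I.vars j 2 → v ≠ I.vars j 3 → x' v = x v) ∧
      qDir I B (1, 0) x' = qDir I B (1, 0) x + cval I B j ∧
      ∀ e ∈ B.N, (sys I B).u e x' = (sys I B).u e x + (if j ∈ B.D e then 1 else 0) := by
  classical
  have h23 : I.vars j 2 ≠ I.vars j 3 := fun h => absurd (hI.2 j h) (by decide)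
  have hoff : ∀ (v : Fin n) (t : Fin 4), v ≠ I.vars j t → (Pi.single (I.vars j t) (1 : ZMod 2) : Fin n → ZMod 2) v = 0 :=
    fun v t hv => by rw [Pi.single_apply, if_neg hv]
  have two : (2 : Fin 4) = 2 ∨ (2 : Fin 4) = 3 := Or.inl rfl
  have three : (3 : Fin 4) = 2 ∨ (3 : Fin 4) = 3 := Or.inr rfl
  rcases (by decide : ∀ t : ZMod 2, t = 0 ∨ t = 1) (x (I.vars j 3)) with hb | hb
  · rcases (by decide : ∀ t : ZMod 2, t = 0 ∨ t = 1) (x (I.vars j 2)) with ha | ha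
    · -- both off: switch `a` on (no change), then `b`
      set y := x + Pi.single (I.vars j 2) 1 with hy
      have hya : y (I.vars j 2) = 1 := by rw [hy, Pi.add_apply, ha, Pi.single_eq_same, zero_add]
      refine ⟨y + Pi.single (I.vars j 3) 1, fun v hv2 hv3 => ?_, ?_, fun e he => ?_⟩
      · rw [Pi.add_apply, hy, Pi.add_apply, hoff v 2 hv2, hoff v 3 hv3, add_zero, add_zero]
      · rw [qDir_add_single I hj three two (by decide), hy, qDir_add_single I hj two three (by decide), hb, zero_mul, add_zero, ← hy, hya,
          one_mul, cval, polarDir_symm]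
      · rw [u_add_single I hI hS hW he hj.1 three two (by decide), hy, u_add_single I hI hS hW he hj.1 two three (by decide), hb, zero_mul,
          add_zero, ← hy, hya, one_mul]
    · -- `a` on, `b` off: switch `b` on
      refine ⟨x + Pi.single (I.vars j 3) 1, fun v hv2 hv3 => ?_, ?_, fun e he => ?_⟩
      · rw [Pi.add_apply, hoff v 3 hv3, add_zero]
      · rw [qDir_add_single I hj three two (by decide), ha, one_mul, cval, polarDir_symm]
      · rw [u_add_single I hI hS hW he hj.1 three two (by decide), ha, one_mul]
  · -- `b` on: flip `a`
    refine ⟨x + Pi.single (I.vars j 2) 1, fun v hv2 hv3 => ?_, ?_, fun e he => ?_⟩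
    · rw [Pi.add_apply, hoff v 2 hv2, add_zero]
    · rw [qDir_add_single I hj two three (by decide), hb, one_mul, cval]
    · rw [u_add_single I hI hS hW he hj.1 two three (by decide), hb, one_mul]

/-! ## The constants `c_j` -/

/-- **A controlled private edge of `D_p ∖ D_q` has `c_j = 1`** (regime P, node N1). -/
theorem cval_eq_one_of_A (hI : I.IsPure xorAndPred) (hT : Typed I) (hS : SimpleOverlap I) (hD : CrossData I r B e_p e_q g₀)
    (hSR : ((sys I B).vsys e_p e_q).SingleRead) {a : Fin m} (ha : Controlled I B a) (hap : a ∈ B.D e_p) (haq : a ∉ B.D e_q) :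
    cval I B a = 1 := by
  obtain ⟨x, hq, hp, hq'⟩ := exists_q_p I hI hT hD hSR
  obtain ⟨x', -, hqx, hux⟩ := toggle I hI hS hD.wf ha x
  have hp' := hux e_p hD.mem_p
  have hq'' := hux e_q hD.mem_q
  rw [if_pos hap, hp] at hp'
  rw [if_neg haq, hq', add_zero] at hq''
  have h1 := corner_const I hI hT hD hSR x' (by rw [hp']; decide) hq''
  rw [hqx, hq, zero_add] at h1
  exact h1

/-- **A controlled private edge of `D_q ∖ D_p` has `c_j = 1`.** -/
theorem cval_eq_one_of_B (hI : I.IsPure xorAndPred) (hT : Typed I) (hS : SimpleOverlap I) (hD : CrossData I r B e_p e_q g₀)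
    (hSR : ((sys I B).vsys e_p e_q).SingleRead) {b : Fin m} (hb : Controlled I B b) (hbp : b ∉ B.D e_p) (hbq : b ∈ B.D e_q) :
    cval I B b = 1 := by
  obtain ⟨x, hq, hp, hq'⟩ := exists_q_q I hI hT hD hSR
  obtain ⟨x', -, hqx, hux⟩ := toggle I hI hS hD.wf hb x
  have hp' := hux e_p hD.mem_p
  have hq'' := hux e_q hD.mem_q
  rw [if_neg hbp, hp, add_zero] at hp'
  rw [if_pos hbq, hq'] at hq''
  have h1 := corner_const I hI hT hD hSR x' hp' (by rw [hq'']; decide)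
  rw [hqx, hq, zero_add] at h1
  exact h1

/-- **A controlled private edge of `D_p ∩ D_q` together with one of `D_q ∖ D_p`: `c_c + c_b = 1`** (so `c_c = 0` when `c_b = 1`). -/
theorem cval_C_add (hI : I.IsPure xorAndPred) (hT : Typed I) (hS : SimpleOverlap I) (hD : CrossData I r B e_p e_q g₀)
    (hSR : ((sys I B).vsys e_p e_q).SingleRead) {c b : Fin m} (hc : Controlled I B c) (hcp : c ∈ B.D e_p) (hcq : c ∈ B.D e_q)
    (hb : Controlled I B b) (hbp : b ∉ B.D e_p) (hbq : b ∈ B.D e_q) : cval I B c + cval I B b = 1 := by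
  obtain ⟨x, hq, hp, hq'⟩ := exists_q_p I hI hT hD hSR
  obtain ⟨x', -, hqx, hux⟩ := toggle I hI hS hD.wf hc x
  obtain ⟨x'', -, hqx', hux'⟩ := toggle I hI hS hD.wf hb x'
  have hp'' : (sys I B).u e_p x'' = 0 := by
    rw [hux' e_p hD.mem_p, hux e_p hD.mem_p, if_pos hcp, if_neg hbp, hp]; decide
  have hq'' : (sys I B).u e_q x'' = 0 := by
    rw [hux' e_q hD.mem_q, hux e_q hD.mem_q, if_pos hcq, if_pos hbq, hq']; decide
  have h1 := corner_const I hI hT hD hSR x'' hp'' hq''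
  rw [hqx', hqx, hq, zero_add] at h1
  exact h1

end

end Summit.PneNP.PneNP.Theorems.PstarCrossCasePEmptyToggle
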